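import Mathlib
import Summits.NavierStokesRegularity.NavierStokesRegularity.Theses.PoloidalWindowDoor
import Summits.NavierStokesRegularity.NavierStokesRegularity.Theorems.PoloidalWindowDoorPoloidalWindowRigidityHorizontalMean

/-!
# Crux `PoloidalWindowRigidity` (stmt-NavierStokesRegularity-19708) — strategist g5 census sketch (typed statements only)

Typed companions of `STRATEGY-CENSUS-g5.md` / `Ideas/plane-envelope.md` (seat cstrat-stmt-NavierStokesRegularity-19708-g5).
Nothing here is a route item or a registered stub; the `def … : Prop` are the signatures the census refers to.

* `SteadySimilarityFluxLiouville` — the 1-D ENGINE of the plane-envelope law in similarity variables (steady / DSS case):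
  a bounded non-negative `Ω` whose similarity flux `(S + ζ/2)·Ω − Ω′` is non-increasing vanishes identically.  TRUE (census §Transfer-2, proof in 6 lines).
* `PlaneMeanZero` — PLANE-FLUX LEMMA (PF): horizontal means of `v₂` on large discs vanish for every class profile.  TRUE (census §Transfer-1).
* `SelfSimilarBoundedOscEmpty` — RUNG: the backward-self-similar, globally (TH), bounded-Clebsch-oscillation residue is regular at the apex.
* `BoundedOscResidueEmpty` — S⁺ of §Strengthen: the same without self-similarity (open above the bump threshold `B ≥ √2`).
* `EnvelopeLiouville1D` — the pure 1-D endgame of §Decomposition; REFUTABLE for large `B` (stationary similarity bumps), recorded as a negative.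

WHAT THIS IS NOT: not a claim about Navier–Stokes regularity; not a line; not a proof of the crux.
-/

namespace Summit.NavierStokesRegularity.NavierStokesRegularity.Cruxes.PoloidalWindowRigidity.CensusG5

open Filter Topology
set_option linter.dupNamespace false
open scoped RealInnerProductSpace InnerProductSpace

/-- 1-D ENGINE (steady similarity flux Liouville).  If `Ω ≥ 0` is bounded and `C¹`, `S` is bounded, and the similarity flux
`F ζ = (S ζ + ζ/2) * Ω ζ - deriv Ω ζ` is non-increasing on `ℝ`, then `Ω ≡ 0`.
(Proof: `F ≥ 0` else `Ω′ ≥ |F(ζ₁)|` for `ζ ≥ max ζ₁ (2σ)`; `F ≤ 0` symmetrically; so `Ω′ = (S + ζ/2)Ω`, `Ω = Ω 0 · exp(ζ²/4 + ∫S)`, bounded ⇒ `Ω 0 = 0`.) -/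
def SteadySimilarityFluxLiouville : Prop :=
  ∀ (Ω S : ℝ → ℝ), ContDiff ℝ 1 Ω → Continuous S →
    (∀ ζ, 0 ≤ Ω ζ) → (∃ B : ℝ, ∀ ζ, Ω ζ ≤ B) → (∃ σ : ℝ, ∀ ζ, |S ζ| ≤ σ) →
    Antitone (fun ζ => (S ζ + ζ / 2) * Ω ζ - deriv Ω ζ) →
    ∀ ζ, Ω ζ = 0

/-- PLANE-FLUX LEMMA (PF).  For every class profile (Type-I time decay, continuous, unit-viscosity Oseen-mild, divergence-free) the
horizontal mean of the vertical velocity on the disc of radius `R` in the plane through `c + z e₂` tends to `0` as `R → ∞`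
(tree `hmean`; any normalised bump `φ`). -/
def PlaneMeanZero : Prop :=
  ∀ (C : ℝ) (v : ℝ → EuclideanSpace ℝ (Fin 3) → EuclideanSpace ℝ (Fin 3)),
    Literature.Analysis.FluidPDE.HasTypeITimeDecay C v →
    ContinuousOn (Function.uncurry v) (Set.Iio (0 : ℝ) ×ˢ Set.univ) →
    (∀ s t : ℝ, s < t → t < 0 → ∀ x, v t x =
      Literature.Analysis.UnboundedOperators.heatExtension (v s) (t - s) x -
        Literature.Analysis.FluidPDE.oseenDuhamel 1 s v v t x) →
    (∀ t < 0, Literature.Analysis.FluidPDE.VectorCalculus.IsDivFree (v t)) →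
    ∀ (φ : ContDiffBump (0 : EuclideanSpace ℝ (Fin 2))) (c : EuclideanSpace ℝ (Fin 3)) (t z : ℝ), t < 0 →
      Tendsto (fun R : ℝ =>
        Summit.NavierStokesRegularity.NavierStokesRegularity.Theorems.PoloidalWindowDoorPoloidalWindowRigidityHorizontalMean.hmean
          φ c R z (fun x => v t x 2)) atTop (𝓝 0)

/-- RUNG (self-similar, bounded Clebsch oscillation).  Class + poloidal + GLOBAL time–height proportional shear
`∂₂v_b(t,x) = m t (x 2) · ∂_b v₂(t,x)` (`b = 0,1`) + backward self-similarity + a bound `√(−t)·|1 − m t h|·|v₂(t,x) − v₂(t,y)| ≤ B`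
for all `x, y` on the plane `{x 2 = y 2 = h}` ⇒ the apex is regular.  (Envelope law + `SteadySimilarityFluxLiouville`.) -/
def SelfSimilarBoundedOscEmpty : Prop :=
  ∀ (C : ℝ) (v : ℝ → EuclideanSpace ℝ (Fin 3) → EuclideanSpace ℝ (Fin 3)),
    Literature.Analysis.FluidPDE.HasTypeITimeDecay C v →
    ContinuousOn (Function.uncurry v) (Set.Iio (0 : ℝ) ×ˢ Set.univ) →
    (∀ s t : ℝ, s < t → t < 0 → ∀ x, v t x =
      Literature.Analysis.UnboundedOperators.heatExtension (v s) (t - s) x -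
        Literature.Analysis.FluidPDE.oseenDuhamel 1 s v v t x) →
    (∀ t < 0, Literature.Analysis.FluidPDE.VectorCalculus.IsDivFree (v t)) →
    (∀ s < 0, ∀ y, ⟪Literature.Analysis.FluidPDE.curl (v s) y, EuclideanSpace.single 2 1⟫_ℝ = 0) →
    (∀ lam : ℝ, 0 < lam → ∀ t < 0, ∀ x, v (lam ^ 2 * t) (lam • x) = lam⁻¹ • v t x) →
    ∀ m : ℝ → ℝ → ℝ,
      (∀ t < 0, ∀ x, ∀ b : Fin 3, b ≠ 2 →
        fderiv ℝ (v t) x (EuclideanSpace.single 2 1) b = m t (x 2) * fderiv ℝ (v t) x (EuclideanSpace.single b 1) 2) →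
      (∃ B : ℝ, ∀ t < 0, ∀ x y : EuclideanSpace ℝ (Fin 3), x 2 = y 2 →
        Real.sqrt (-t) * |1 - m t (x 2)| * |v t x 2 - v t y 2| ≤ B) →
      ¬ Literature.Analysis.FluidPDE.IsBackwardSingularPoint v 0

/-- S⁺ (§Strengthen): the bounded-Clebsch-oscillation (TH) residue, no self-similarity.  Thresholded: the envelope law closes it for
`B < √2` at best; above, stationary similarity bumps of the 1-D law exist (census §Decomposition). -/
def BoundedOscResidueEmpty : Prop :=
  ∀ (C : ℝ) (v : ℝ → EuclideanSpace ℝ (Fin 3) → EuclideanSpace ℝ (Fin 3)),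
    Literature.Analysis.FluidPDE.HasTypeITimeDecay C v →
    ContinuousOn (Function.uncurry v) (Set.Iio (0 : ℝ) ×ˢ Set.univ) →
    (∀ s t : ℝ, s < t → t < 0 → ∀ x, v t x =
      Literature.Analysis.UnboundedOperators.heatExtension (v s) (t - s) x -
        Literature.Analysis.FluidPDE.oseenDuhamel 1 s v v t x) →
    (∀ t < 0, Literature.Analysis.FluidPDE.VectorCalculus.IsDivFree (v t)) →
    (∀ s < 0, ∀ y, ⟪Literature.Analysis.FluidPDE.curl (v s) y, EuclideanSpace.single 2 1⟫_ℝ = 0) →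
    ∀ m : ℝ → ℝ → ℝ,
      (∀ t < 0, ∀ x, ∀ b : Fin 3, b ≠ 2 →
        fderiv ℝ (v t) x (EuclideanSpace.single 2 1) b = m t (x 2) * fderiv ℝ (v t) x (EuclideanSpace.single b 1) 2) →
      (∃ B : ℝ, ∀ t < 0, ∀ x y : EuclideanSpace ℝ (Fin 3), x 2 = y 2 →
        Real.sqrt (-t) * |1 - m t (x 2)| * |v t x 2 - v t y 2| ≤ B) →
      ¬ Literature.Analysis.FluidPDE.IsBackwardSingularPoint v 0

/-- §Decomposition, piece END as a PURE 1-D statement (eternal similarity form of the envelope law with the PF bound `|S̃| ≤ Ω̃/2`):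
REFUTABLE for large `sup Ω̃` (stationary bumps `Ω̃ = B·exp(−aζ²)`, census (F3c)); recorded so nobody files it. -/
def EnvelopeLiouville1D : Prop :=
  ∀ (Ω S : ℝ → ℝ → ℝ), ContDiff ℝ 2 (Function.uncurry Ω) → ContDiff ℝ 1 (Function.uncurry S) →
    (∀ s ζ, 0 ≤ Ω s ζ) → (∃ B : ℝ, ∀ s ζ, Ω s ζ ≤ B) → (∀ s ζ, |S s ζ| ≤ Ω s ζ / 2) →
    (∀ s ζ, deriv (fun s' => Ω s' ζ) s + deriv (fun ζ' => (S s ζ' + ζ' / 2) * Ω s ζ') ζ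
        - deriv (fun ζ' => deriv (fun ζ'' => Ω s ζ'') ζ') ζ ≤ 0) →
    ∀ s ζ, Ω s ζ = 0

end Summit.NavierStokesRegularity.NavierStokesRegularity.Cruxes.PoloidalWindowRigidity.CensusG5
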